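import Mathlib
import HarnessLib
import Summits.HubbardSuperconductivity.HubbardSuperconductivity.Theorems.KLProgrammeKLRegimeSplitEngineV10
import Summits.HubbardSuperconductivity.HubbardSuperconductivity.Theorems.KLProgrammeKLRegimeSplitFrameDist

/-!
# Route `KLProgramme` — crux K3, K3-FLOW pricing (plan g15, HOME/planner-g15/K3-FLOW-PRICING.md §4 Q-F1, child 1):
# the (D) leg-count scale sum at a MOVING frame — `card_scales_in_moving_window_le`, `legSliceCountT_flow_sum_le`,
# `legDressBarQ2_countT_flow_sum_le` (cell gate-hubbard-kl, seat hubbard-kl-k3c1-p2 g9, child-1 lineage)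

WHY.  Child 1 of K3 (`betaSplitP_of_slotsV10S` → `betaSplitP_of_edgeClauses` → `pairArrayAtV2_of_edgeClauses_explicit` → the row-0′
cascade) pays the (D) leg-dressing term of the (E2-v10) budget through ONE genuinely cross-scale lemma: along the ladder a fixed
momentum configuration's four legs meet at most `20` slice windows (`legSliceCountT_sum_le`, `legDressBarQ2_countT_sum_le`,
…SplitLegCount §2 / …SplitEngineV10 §1).  Its proof uses that the reading radius `t_K(p) = √((π/β)² + e_K(p)²)` of a leg does NOT
depend on the scale — i.e. that the history's frame is the SAME `K` at every scale.  On a FLOWING-DISPERSION family (BGM 2006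
(2.23): a frame SEQUENCE `K_n`, slice `n` read at `K_n`) the radius moves with `n`.  This module shows the count survives with the
SAME constant under a frame-rate law: if `frameDist K_{j+1} K_j ≤ κ·Λ_j` for every `j` with `κ ≤ 1/32`, each leg still meets at most
five windows `[Λ_{n+2}, Λ_{n−2}]` read at `K_n`, so `Σ_{n ≤ N} legSliceCountT … K_n n k ≤ 20` and
`Σ_{n ≤ N} legDressBarQ2 G P Q U n (legSliceCountT … K_n n k) ≤ 20·Q.CR·((Klam U)² + (Klam|U|)³)` — child 1's numerals
`(sG, sQ, tG, tQ, tN) = (3, 8, 10/3, 48, 15)` and `κ₀ = klLegKappa` are then unchanged on such a family.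

CONTENTS (pure real analysis + finite bookkeeping; nothing about the model is asserted):
* §1 drifting radii: `klScale_sum_Ico_le` (`Σ_{l ∈ [n,m)} Λ_l ≤ (4/3)Λ_n`), `drift_lower_bound` (a sequence with steps
  `|t_{j+1} − t_j| ≤ κΛ_j` loses at most `(4/3)κΛ_n` after scale `n`), `scale_moving_window_le` (two scales `n ≤ m` whose windows hold
  `t_n`, `t_m` are at most `4` apart when `κ ≤ 1/32`), `card_scales_in_moving_window_le` (`≤ 5`);
* §2 model level: `abs_sqrt_sq_add_sq_sub_le` (`|√(a²+x²) − √(a²+y²)| ≤ |x − y|`), `abs_klLegRadius_sub_le_frameDist`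
  (the reading radius is `1`-Lipschitz in the frame for `frameDist`), `legSliceCountT_flow_sum_le`, `legDressBarQ2_countT_flow_sum_le`.
References: HOME/planner-g15/K3-FLOW-PRICING.md §1 row «child 1», §4 Q-F1; `…SplitEngineV4Sums` (`scale_window_le`,
`card_scales_in_window_le`, p1); `…SplitLegCount` (Δ16, k3c2-p3); BGM 2006 [arXiv:cond-mat/0507686] §2.3.
-/

noncomputable section

namespace Summit.HubbardSuperconductivity.HubbardSuperconductivity.Theorems.KLRegimeSplit

set_option linter.dupNamespace false -- summit = problem name (single-conjunct summit), D-0017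

open Real Finset Literature.MathematicalPhysics.QuantumLattice Literature.Probability.LatticeModels
open Summit.HubbardSuperconductivity.HubbardSuperconductivity.Theorems.KLProgrammeLegKernels

/-! ## §1 Drifting reading radii -/

/-- `Σ_{l ∈ [n, m)} Λ_l ≤ (4/3)·Λ_n` (geometric, ratio `1/4`). -/
theorem klScale_sum_Ico_le (n m : ℕ) : ∑ l ∈ Ico n m, klScale klE0 l ≤ 4 / 3 * klScale klE0 n := by
  rcases le_or_gt m n with hmn | hnm
  · rw [Ico_eq_empty_of_le hmn, sum_empty]
    exact mul_nonneg (by norm_num) (klth_klScale_pos n).le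
  · have hshift : ∑ l ∈ Ico n m, klScale klE0 l = ∑ i ∈ range (m - n), klScale klE0 (n + i) := by
      rw [sum_Ico_eq_sum_range]
    rw [hshift]
    have hterm : ∀ i, klScale klE0 (n + i) = klScale klE0 n * ((4 : ℝ)⁻¹) ^ i := by
      intro i
      unfold klScale
      rw [pow_add, mul_inv, inv_pow, mul_assoc]
    simp only [hterm, ← mul_sum]
    rw [mul_comm (4 / 3 : ℝ)]
    refine mul_le_mul_of_nonneg_left ?_ (klth_klScale_pos n).le
    have h := geom_sum_Ico_le_of_lt_one (m := 0) (n := m - n) (x := (4 : ℝ)⁻¹) (by norm_num) (by norm_num)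
    rw [← range_eq_Ico] at h
    exact h.trans (by norm_num)

/-- **Accumulated drift**: if `|t_{j+1} − t_j| ≤ κ·Λ_j` for every `j` (`κ ≥ 0`), then for `n ≤ m`,
`t_n − (4/3)·κ·Λ_n ≤ t_m`. -/
theorem drift_lower_bound {t : ℕ → ℝ} {κ : ℝ} (hκ : 0 ≤ κ) (h : ∀ j, |t (j + 1) - t j| ≤ κ * klScale klE0 j)
    {n m : ℕ} (hnm : n ≤ m) : t n - 4 / 3 * κ * klScale klE0 n ≤ t m := by
  -- telescope: `t n - t m ≤ Σ_{l ∈ [n,m)} |t (l+1) - t l| ≤ κ Σ Λ_l ≤ (4/3) κ Λ_n`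
  have htel : t n - t m ≤ ∑ l ∈ Ico n m, κ * klScale klE0 l := by
    induction m, hnm using Nat.le_induction with
    | base => simp
    | succ m hm ih =>
      rw [sum_Ico_succ_top hm]
      have hstep : t m - t (m + 1) ≤ κ * klScale klE0 m := by
        have := h m
        rw [abs_sub_comm] at this
        exact (le_abs_self _).trans this
      linarith
  have hsum : ∑ l ∈ Ico n m, κ * klScale klE0 l ≤ κ * (4 / 3 * klScale klE0 n) := by
    rw [← mul_sum]
    exact mul_le_mul_of_nonneg_left (klScale_sum_Ico_le n m) hκ
  nlinarith

/-- **Two scales in a moving window are at most `4` apart**: if `|t_{j+1} − t_j| ≤ κ·Λ_j` with `0 ≤ κ ≤ 1/32`, `n ≤ m`,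
`Λ_{n+2} ≤ t_n` and `t_m ≤ Λ_{m−2}`, then `m ≤ n + 4` (at `κ = 0` this is `scale_window_le`; the drift costs
`(4/3)κΛ_n ≤ Λ_n/24 < Λ_n/16 − Λ_n/48`). -/
theorem scale_moving_window_le {t : ℕ → ℝ} {κ : ℝ} (hκ0 : 0 ≤ κ) (hκ : κ ≤ 1 / 32)
    (h : ∀ j, |t (j + 1) - t j| ≤ κ * klScale klE0 j) {n m : ℕ} (hnm : n ≤ m)
    (hn : klScale klE0 (n + 2) ≤ t n) (hm : t m ≤ klScale klE0 (m - 2)) : m ≤ n + 4 := by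
  have hΛn := klth_klScale_pos n
  have hdrift := drift_lower_bound hκ0 h hnm
  have h16 : klScale klE0 (n + 2) = klScale klE0 n / 16 := by
    rw [show n + 2 = (n + 1) + 1 by omega, klth_klScale_succ, klth_klScale_succ]; ring
  -- `Λ_n / 48 ≤ t m ≤ Λ_{m-2}`
  have hlow : klScale klE0 n / 48 ≤ klScale klE0 (m - 2) := by
    have h1 : 4 / 3 * κ * klScale klE0 n ≤ klScale klE0 n / 24 := by nlinarith
    linarith
  -- compare powers of `4`
  have he : (0 : ℝ) < klE0 := by norm_num [klE0]
  unfold klScale at hlow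
  have hlow' : ((4 : ℝ) ^ n)⁻¹ / 48 ≤ ((4 : ℝ) ^ (m - 2))⁻¹ := by
    have := div_le_div_of_nonneg_right (c := klE0) hlow he.le
    rw [show klE0 * ((4 : ℝ) ^ n)⁻¹ / 48 / klE0 = ((4 : ℝ) ^ n)⁻¹ / 48 by field_simp,
      show klE0 * ((4 : ℝ) ^ (m - 2))⁻¹ / klE0 = ((4 : ℝ) ^ (m - 2))⁻¹ by field_simp] at this
    exact this
  have h4n : (0 : ℝ) < (4 : ℝ) ^ n := by positivity
  have h4m : (0 : ℝ) < (4 : ℝ) ^ (m - 2) := by positivity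
  have hpow : (4 : ℝ) ^ (m - 2) ≤ 48 * (4 : ℝ) ^ n := by
    rw [div_le_iff₀ (by norm_num : (0 : ℝ) < 48)] at hlow'
    have := mul_le_mul_of_nonneg_left hlow' (le_of_lt (mul_pos h4n h4m))
    have e1 : (4 : ℝ) ^ n * (4 : ℝ) ^ (m - 2) * ((4 : ℝ) ^ n)⁻¹ = (4 : ℝ) ^ (m - 2) := by field_simp
    have e2 : (4 : ℝ) ^ n * (4 : ℝ) ^ (m - 2) * (((4 : ℝ) ^ (m - 2))⁻¹ * 48) = 48 * (4 : ℝ) ^ n := by field_simp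
    rw [e1, e2] at this
    exact this
  have hlt : (4 : ℝ) ^ (m - 2) < (4 : ℝ) ^ (n + 3) := by
    calc (4 : ℝ) ^ (m - 2) ≤ 48 * (4 : ℝ) ^ n := hpow
      _ < 64 * (4 : ℝ) ^ n := by nlinarith
      _ = (4 : ℝ) ^ (n + 3) := by rw [pow_add]; norm_num; ring
  have h3 : m - 2 < n + 3 := (pow_lt_pow_iff_right₀ (by norm_num : (1 : ℝ) < 4)).mp hlt
  omega

/-- **For ONE drifting leg radius, the scales `n ≤ N` whose window `[Λ_{n+2}, Λ_{n−2}]` contains `t_n` number at most five**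
(moving-frame twin of `card_scales_in_window_le`). -/
theorem card_scales_in_moving_window_le (t : ℕ → ℝ) {κ : ℝ} (hκ0 : 0 ≤ κ) (hκ : κ ≤ 1 / 32)
    (h : ∀ j, |t (j + 1) - t j| ≤ κ * klScale klE0 j) (N : ℕ) :
    ((range (N + 1)).filter fun n => klScale klE0 (n + 2) ≤ t n ∧ t n ≤ klScale klE0 (n - 2)).card ≤ 5 := by
  set S := (range (N + 1)).filter fun n => klScale klE0 (n + 2) ≤ t n ∧ t n ≤ klScale klE0 (n - 2) with hS
  by_cases hne : S.Nonempty
  · set m := S.min' hne with hm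
    have hmS : m ∈ S := min'_mem S hne
    have hsub : S ⊆ Icc m (m + 4) := by
      intro n hn
      rw [mem_Icc]
      have hmn : m ≤ n := min'_le S n hn
      refine ⟨hmn, ?_⟩
      have hn' := (mem_filter.mp hn).2
      have hm' := (mem_filter.mp hmS).2
      exact scale_moving_window_le hκ0 hκ h hmn hm'.1 hn'.2
    calc S.card ≤ (Icc m (m + 4)).card := card_le_card hsub
      _ = 5 := by rw [Nat.card_Icc]; omega
  · rw [not_nonempty_iff_eq_empty.mp hne, card_empty]; norm_num

/-! ## §2 Model level: the count at a flowing frame -/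

/-- `|√(a² + x²) − √(a² + y²)| ≤ |x − y|` (the Euclidean norm of `(a, ·)` is `1`-Lipschitz). -/
theorem abs_sqrt_sq_add_sq_sub_le (a x y : ℝ) :
    |Real.sqrt (a ^ 2 + x ^ 2) - Real.sqrt (a ^ 2 + y ^ 2)| ≤ |x - y| := by
  -- one direction, then symmetry
  have key : ∀ x y : ℝ, Real.sqrt (a ^ 2 + x ^ 2) ≤ Real.sqrt (a ^ 2 + y ^ 2) + |x - y| := by
    intro x y
    set r := Real.sqrt (a ^ 2 + y ^ 2) with hr
    have hr0 : 0 ≤ r := Real.sqrt_nonneg _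
    have hr2 : r ^ 2 = a ^ 2 + y ^ 2 := Real.sq_sqrt (by positivity)
    have hyr : |y| ≤ r := Real.abs_le_sqrt (by nlinarith [sq_nonneg a])
    have h1 : y * (x - y) ≤ |y| * |x - y| := by rw [← abs_mul]; exact le_abs_self _
    have h2 : |y| * |x - y| ≤ r * |x - y| := mul_le_mul_of_nonneg_right hyr (abs_nonneg _)
    have hsq : a ^ 2 + x ^ 2 ≤ (r + |x - y|) ^ 2 := by nlinarith [sq_abs (x - y), abs_nonneg (x - y)]
    calc Real.sqrt (a ^ 2 + x ^ 2) ≤ Real.sqrt ((r + |x - y|) ^ 2) := Real.sqrt_le_sqrt hsq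
      _ = r + |x - y| := Real.sqrt_sq (by positivity)
  rw [abs_sub_le_iff]
  constructor
  · linarith [key x y]
  · have := key y x
    rw [abs_sub_comm] at this
    linarith

section Model

variable (L M : ℕ) [NeZero L] [NeZero M]

omit [NeZero L] in
/-- **The reading radius is `1`-Lipschitz in the frame**: `|t_K(p) − t_{K′}(p)| ≤ |K(p) − K′(p)| ≤ frameDist K K′`. -/
theorem abs_klLegRadius_sub_le_frameDist (β μ : ℝ) (K K' : TrigPolyC4v) (k : TorusSite 2 L) :
    |klLegRadius L β μ K k - klLegRadius L β μ K' k| ≤ frameDist K K' := by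
  unfold klLegRadius
  refine (abs_sqrt_sq_add_sq_sub_le _ _ _).trans ?_
  have hd : nambuXiCT L μ K k - nambuXiCT L μ K' k = -(K.eval (latticeMomentum L k) - K'.eval (latticeMomentum L k)) := by
    simp only [nambuXiCT]; ring
  rw [hd, abs_neg]
  exact abs_eval_sub_le_frameDist K K' _

omit [NeZero L] in
/-- **(D) summed at a FLOWING frame**: for a frame sequence `K_n` with `frameDist K_{j+1} K_j ≤ κ·Λ_j` (`0 ≤ κ ≤ 1/32`), a momentum
configuration's four legs — slice `n` read at `K_n` — meet at most `20` windows along the ladder (same constant as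
`legSliceCountT_sum_le`). -/
theorem legSliceCountT_flow_sum_le (β μ : ℝ) (Kf : ℕ → TrigPolyC4v) {κ : ℝ} (hκ0 : 0 ≤ κ) (hκ : κ ≤ 1 / 32)
    (hrate : ∀ j, frameDist (Kf (j + 1)) (Kf j) ≤ κ * klScale klE0 j) (k : Fin 4 → TorusSite 2 L) (N : ℕ) :
    ∑ n ∈ range (N + 1), legSliceCountT L β μ (Kf n) n k ≤ 20 := by
  simp only [legSliceCountT, Finset.card_filter]
  rw [Finset.sum_comm]
  refine (sum_le_sum (g := fun _ : Fin 4 => 5) fun i _ => ?_).trans (by simp)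
  rw [← Finset.card_filter]
  exact card_scales_in_moving_window_le (fun n => klLegRadius L β μ (Kf n) (k i)) hκ0 hκ
    (fun j => (abs_klLegRadius_sub_le_frameDist L β μ (Kf (j + 1)) (Kf j) (k i)).trans (hrate j)) N

omit [NeZero L] in
/-- **(D) summed, `Q`-staged real form, at a FLOWING frame**: `Σ_{n ≤ N} legDressBarQ2 G P Q U n (legSliceCountT … K_n n k) ≤
20·Q.CR·((Klam U)² + (Klam|U|)³)` under the same frame-rate law (same constant as `legDressBarQ2_countT_sum_le`). -/
theorem legDressBarQ2_countT_flow_sum_le (G : GeoConsts) {P : SplitConsts} {Q : EngConsts} (hK : 0 ≤ P.Klam) (hQ : 0 ≤ Q.CR)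
    (U β μ : ℝ) (Kf : ℕ → TrigPolyC4v) {κ : ℝ} (hκ0 : 0 ≤ κ) (hκ : κ ≤ 1 / 32)
    (hrate : ∀ j, frameDist (Kf (j + 1)) (Kf j) ≤ κ * klScale klE0 j) (k : Fin 4 → TorusSite 2 L) (N : ℕ) :
    ∑ n ∈ range (N + 1), legDressBarQ2 G P Q U n (legSliceCountT L β μ (Kf n) n k) ≤
      20 * (Q.CR * ((P.Klam * U) ^ 2 + (P.Klam * |U|) ^ 3)) := by
  have hcub : 0 ≤ (P.Klam * |U|) ^ 3 := pow_nonneg (mul_nonneg hK (abs_nonneg U)) 3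
  simp only [legDressBarQ2_eq]
  rw [← Finset.mul_sum, mul_comm (20 : ℝ)]
  refine mul_le_mul_of_nonneg_left ?_ (mul_nonneg hQ (add_nonneg (sq_nonneg _) hcub))
  exact_mod_cast legSliceCountT_flow_sum_le L β μ Kf hκ0 hκ hrate k N

end Model

end Summit.HubbardSuperconductivity.HubbardSuperconductivity.Theorems.KLRegimeSplit

end
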